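import Mathlib.Analysis.SpecialFunctions.SmoothTransition
import Mathlib.Analysis.InnerProductSpace.Calculus
import Mathlib.Analysis.Calculus.Deriv.Inv
import Mathlib.Analysis.Calculus.Deriv.Comp
import Mathlib.Geometry.Manifold.MFDeriv.FDeriv
import Mathlib.Geometry.Manifold.ContMDiffMFDeriv
import Literature.Topology.FourManifolds.SliceGenus
import HarnessLib

/-!
# Concordance invariance of the slice genus: symmetry of concordance and the gluing decomposition
(trunk T-4MAN / FourManL)

The named fact `Literature.Topology.FourManifolds.Knot.IsConcordant.sliceGenus_eq` of `SliceGenus` ("`g₄` is a concordance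
invariant", Livingston 2005, §9.5 — stated there without proof) is reduced here to three classical
ingredients, and the parts that need no differential topology beyond Mathlib are proved:

* `Literature.Topology.FourManifolds.Knot.IsConcordant.swap` (**proved**): concordance in the sense of `Literature.Topology.FourManifolds.Knot.IsConcordance`
  (a neat annulus in the shell `1 ≤ ‖y‖ ≤ 2` from `K` to `2 • K'`) is symmetric: compose with the
  time flip `t ↦ 3 - t` and the inversion `y ↦ 2 y / ‖y‖ ²` of the shell, which swaps the two
  boundary spheres.
* `Literature.Knot.HasRadialSliceSurfaceOfGenus K g` (definition): a slice surface of genus `g` which is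
  *radial near its boundary*, `F p = ‖F p‖ • K (π p)` whenever `1 - δ < ‖F p‖`.
* `Literature.Topology.FourManifolds.Knot.HasSliceSurfaceOfGenus.exists_radial` (named fact **A**): slice surfaces can be made
  radial near the boundary without changing the genus (collaring theorem + straightening).
* `Literature.Topology.FourManifolds.Knot.IsConcordant.exists_radial` (named fact **B**): a concordance can be chosen radial,
  `f (x, t) = t • K x`, for `t ∈ [1, 1 + δ]` (neat submanifolds are vertical in a suitable collar).
* `Literature.Topology.FourManifolds.Knot.HasRadialSliceSurfaceOfGenus.glue` (named fact **C**, **proved**: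
  `HasRadialSliceSurfaceOfGenus.glue_holds`): a radial slice surface for `K` in `B⁴` and a
  concordance from `K` to `K'` radial near `t = 1` glue, after scaling by `1/2`, to a slice
  surface for `K'` of the same genus (the abstract surface is unchanged: the radial collar band
  is reparametrised over collar ∪ annulus).
* `Literature.Topology.FourManifolds.Knot.HasSliceSurfaceOfGenus.of_isConcordant_of_facts`,
  `Literature.Topology.FourManifolds.Knot.IsConcordant.sliceGenus_eq_of_facts` (**proved** assembly): A, B, C and `swap` give
  `IsConcordant.sliceGenus_eq`; with C discharged, `IsConcordant.sliceGenus_eq` is reduced to the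
  two straightening facts A and B.

## Sources

* C. Livingston, *A survey of classical knot concordance*, Handbook of knot theory (2005), §9.5
  (`g₄` is a concordance invariant; no proof printed), §1 and §2.1 (concordance; §1 records that
  it is an equivalence relation). [Livingston2005]
* R. H. Fox, J. W. Milnor, *Singularities of 2-spheres in 4-space and cobordism of knots*, Osaka
  J. Math. 3 (1966) (concordance is an equivalence relation). [FoxMilnor1966]
* M. W. Hirsch, *Differential Topology*, GTM 33 (1976), Ch. 4 §6, Thm. 6.1 (collaring theorem),
  Thm. 6.2 (collars adapted to a neat submanifold); Ch. 8 §2 (gluing manifolds along boundaries).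
  [HirschDT1976]
* A. A. Kosinski, *Differential Manifolds* (1993), I §7 (collars), II (2.8.2) (a neat submanifold
  meets a suitable collar of the boundary in a collar), VI §5 (`M₁ ∪_h M₂`). [Kosinski1993]
* Mathlib: `Real.smoothTransition`, `mfderiv`, `mfderiv_comp`, `contDiff_norm_sq`; H21:
  `Literature.Topology.FourManifolds.Knot.IsConcordance`, `Literature.Topology.FourManifolds.Knot.HasSliceSurfaceOfGenus`, `Literature.Topology.FourManifolds.Knot.sliceGenus`.

## Design choices

* The inversion of the shell is cut off near the origin (`shellInversion y = (2 ρ(‖y‖²)) • y` with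
  `ρ s = 1/s` for `s ≥ 1/4` and `ρ s = 0` for `s ≤ 1/8`) so that the reversed concordance is `C^∞`
  on all of `𝕊 1 × ℝ`, as `IsConcordance` demands, without any hypothesis on `f` off the annulus.
  Injectivity of derivatives is obtained from involutivity (`σ ∘ σ = id`) and the chain rule, never
  from explicit formulas.
* Facts A–C are stated for the H21 notions exactly as defined (`HasSliceSurfaceOfGenus` does not
  require neatness along `∂B⁴`; fact A absorbs this).  In `HasRadialSliceSurfaceOfGenus` the
  angular part `π` is recorded together with its smoothness on the radial band; it is determined by
  `F` (`K` is injective) and its smoothness is automatic (`K` is an immersion), but carrying it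
  avoids re-deriving this in consumers.
* Notation `𝔼 n`, `𝕊 n` is local, exactly as in `SliceGenus`.
-/

open scoped Manifold ContDiff Topology
open Function Set

noncomputable section

namespace Literature.Topology.FourManifolds

/-- Local notation: `𝔼 n` is the model Euclidean space `EuclideanSpace ℝ (Fin n)`. -/
local notation "𝔼 " n:arg => EuclideanSpace ℝ (Fin n)

/-- Local notation: `𝕊 n` is the unit sphere in `EuclideanSpace ℝ (Fin (n + 1))`. -/
local notation "𝕊 " n:arg => (Metric.sphere (0 : EuclideanSpace ℝ (Fin (n + 1))) 1)

namespace Knot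

/-! ## Symmetry of concordance -/

namespace IsConcordance

/-- The smooth cut-off `ρ` of `s ↦ 1/s`: equal to `1/s` for `s ≥ 1/4` and to `0` for `s ≤ 1/8`
(built from `Real.smoothTransition`). Auxiliary for `shellInversion`. [folklore] -/
def invCutoff (s : ℝ) : ℝ :=
  Real.smoothTransition (8 * s - 1) * s⁻¹

/-- `invCutoff s = 1/s` for `s ≥ 1/4`. [folklore] -/
theorem invCutoff_eq_inv {s : ℝ} (hs : 1 / 4 ≤ s) : invCutoff s = s⁻¹ := by
  unfold invCutoff
  rw [Real.smoothTransition.one_of_one_le (by linarith), one_mul]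

/-- `invCutoff s = 0` for `s ≤ 1/8`. [folklore] -/
theorem invCutoff_eq_zero {s : ℝ} (hs : s ≤ 1 / 8) : invCutoff s = 0 := by
  unfold invCutoff
  rw [Real.smoothTransition.zero_of_nonpos (by linarith), zero_mul]

/-- `invCutoff` is `C^∞` (it vanishes near `0`). [folklore] -/
theorem contDiff_invCutoff : ContDiff ℝ ∞ invCutoff := by
  rw [contDiff_iff_contDiffAt]
  intro s
  rcases lt_or_ge s (1 / 8) with hs | hs
  · have hev : invCutoff =ᶠ[𝓝 s] fun _ ↦ 0 := by
      filter_upwards [Iio_mem_nhds hs] with u hu using invCutoff_eq_zero hu.le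
    exact contDiffAt_const.congr_of_eventuallyEq hev
  · have hs0 : s ≠ 0 := by positivity
    have h1 : ContDiff ℝ ∞ fun u : ℝ ↦ Real.smoothTransition (8 * u - 1) :=
      Real.smoothTransition.contDiff.comp ((contDiff_const.mul contDiff_id).sub contDiff_const)
    exact h1.contDiffAt.mul (contDiffAt_inv ℝ hs0)

/-- The **inversion of the shell** `{1 ≤ ‖y‖ ≤ 2} ⊂ ℝ⁴`, `y ↦ 2 y / ‖y‖²` (cut off to `0` near the
origin so as to be `C^∞` on all of `ℝ⁴`): it swaps the spheres of radius `1` and `2` and is an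
involution on `{1/2 ≤ ‖y‖ ≤ 4}`.  Used to reverse concordances. [folklore] -/
def shellInversion (y : 𝔼 4) : 𝔼 4 :=
  (2 * invCutoff (‖y‖ ^ 2)) • y

/-- `shellInversion` is `C^∞` on `ℝ⁴`. [folklore] -/
theorem contDiff_shellInversion : ContDiff ℝ ∞ shellInversion :=
  (contDiff_const.mul (contDiff_invCutoff.comp (contDiff_norm_sq ℝ))).smul contDiff_id

/-- Away from the cut-off, `shellInversion y = (2 / ‖y‖²) • y`. [folklore] -/
theorem shellInversion_eq {y : 𝔼 4} (hy : 1 / 2 ≤ ‖y‖) :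
    shellInversion y = (2 * (‖y‖ ^ 2)⁻¹) • y := by
  unfold shellInversion
  rw [invCutoff_eq_inv (by nlinarith)]

/-- `‖shellInversion y‖ = 2 / ‖y‖` away from the cut-off. [folklore] -/
theorem norm_shellInversion {y : 𝔼 4} (hy : 1 / 2 ≤ ‖y‖) : ‖shellInversion y‖ = 2 / ‖y‖ := by
  have hy0 : ‖y‖ ≠ 0 := by linarith
  rw [shellInversion_eq hy, norm_smul, Real.norm_of_nonneg (by positivity)]
  field_simp

/-- `shellInversion` is an involution on the thick shell `1/2 ≤ ‖y‖ ≤ 4`. [folklore] -/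
theorem shellInversion_shellInversion {y : 𝔼 4} (hy : 1 / 2 ≤ ‖y‖) (hy' : ‖y‖ ≤ 4) :
    shellInversion (shellInversion y) = y := by
  have hy0 : 0 < ‖y‖ := by linarith
  have h1 : 1 / 2 ≤ ‖shellInversion y‖ := by
    rw [norm_shellInversion hy, le_div_iff₀ hy0]
    linarith
  rw [shellInversion_eq h1, norm_shellInversion hy, shellInversion_eq hy, smul_smul]
  conv_rhs => rw [← one_smul ℝ y]
  congr 1
  field_simp

/-- The derivative of `shellInversion` at a point of the shell `1 ≤ ‖y‖ ≤ 2` is injective (chain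
rule applied to `shellInversion ∘ shellInversion = id` near `y`). [folklore] -/
theorem fderiv_shellInversion_injective {y : 𝔼 4} (hy : 1 ≤ ‖y‖) (hy' : ‖y‖ ≤ 2) :
    Injective (fderiv ℝ shellInversion y) := by
  have hev : shellInversion ∘ shellInversion =ᶠ[𝓝 y] id := by
    have hU : {z : 𝔼 4 | 1 / 2 < ‖z‖ ∧ ‖z‖ < 4} ∈ 𝓝 y :=
      ((isOpen_lt continuous_const continuous_norm).inter
        (isOpen_lt continuous_norm continuous_const)).mem_nhds
          (show 1 / 2 < ‖y‖ ∧ ‖y‖ < 4 from ⟨by linarith, by linarith⟩)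
    filter_upwards [hU] with z hz using shellInversion_shellInversion hz.1.le hz.2.le
  have hd : ∀ z, DifferentiableAt ℝ shellInversion z := fun z ↦
    contDiff_shellInversion.contDiffAt.differentiableAt (by simp)
  have key : (fderiv ℝ shellInversion (shellInversion y)).comp (fderiv ℝ shellInversion y) =
      ContinuousLinearMap.id ℝ (𝔼 4) := by
    rw [← fderiv_comp y (hd _) (hd y), hev.fderiv_eq, fderiv_id]
  intro v w h
  have h' := congrArg (fderiv ℝ shellInversion (shellInversion y)) h
  rwa [← ContinuousLinearMap.comp_apply, ← ContinuousLinearMap.comp_apply, key] at h'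

/-- The **time flip** `(x, t) ↦ (x, 3 - t)` of `𝕊 1 × ℝ`, exchanging the levels `t = 1` and
`t = 2`. [folklore] -/
def timeFlip (p : (𝕊 1) × ℝ) : (𝕊 1) × ℝ :=
  (p.1, 3 - p.2)

/-- `timeFlip` is an involution. [folklore] -/
@[simp]
theorem timeFlip_timeFlip (p : (𝕊 1) × ℝ) : timeFlip (timeFlip p) = p := by
  simp [timeFlip]

/-- Components of `timeFlip`. [folklore] -/
@[simp]
theorem timeFlip_apply (x : 𝕊 1) (t : ℝ) : timeFlip (x, t) = (x, 3 - t) := rfl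

/-- `timeFlip` is `C^∞`. [folklore] -/
theorem contMDiff_timeFlip :
    ContMDiff ((𝓡 1).prod 𝓘(ℝ, ℝ)) ((𝓡 1).prod 𝓘(ℝ, ℝ)) ∞ timeFlip :=
  contMDiff_fst.prodMk
    (((contDiff_const (c := (3 : ℝ))).sub contDiff_id).contMDiff.comp contMDiff_snd)

/-- The derivative of `timeFlip` is injective (chain rule on `timeFlip ∘ timeFlip = id`). [folklore] -/
theorem mfderiv_timeFlip_injective (p : (𝕊 1) × ℝ) :
    Injective (mfderiv ((𝓡 1).prod 𝓘(ℝ, ℝ)) ((𝓡 1).prod 𝓘(ℝ, ℝ)) timeFlip p) := by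
  have hd : ∀ q, MDifferentiableAt ((𝓡 1).prod 𝓘(ℝ, ℝ)) ((𝓡 1).prod 𝓘(ℝ, ℝ)) timeFlip q :=
    fun q ↦ contMDiff_timeFlip.mdifferentiableAt (by simp)
  have key := mfderiv_comp p (hd (timeFlip p)) (hd p)
  rw [show timeFlip ∘ timeFlip = id from funext timeFlip_timeFlip, mfderiv_id] at key
  intro v w h
  have h' := congrArg (mfderiv ((𝓡 1).prod 𝓘(ℝ, ℝ)) ((𝓡 1).prod 𝓘(ℝ, ℝ)) timeFlip (timeFlip p)) h
  rwa [← ContinuousLinearMap.comp_apply, ← ContinuousLinearMap.comp_apply, ← key] at h'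

/-- The **reverse** of an annulus `f : 𝕊 1 × ℝ → ℝ⁴`: flip time and invert the shell.
For a concordance from `K` to `K'` this is a concordance from `K'` to `K`
(`reverse_isConcordance`). Fox–Milnor (1966), §1; Livingston (2005), §2.1. [cite: FoxMilnor1966, §1] -/
def reverse (f : (𝕊 1) × ℝ → 𝔼 4) : (𝕊 1) × ℝ → 𝔼 4 :=
  shellInversion ∘ (f ∘ timeFlip)

/-- Pointwise formula for `reverse`. [folklore] -/
theorem reverse_apply (f : (𝕊 1) × ℝ → 𝔼 4) (x : 𝕊 1) (t : ℝ) :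
    reverse f (x, t) = shellInversion (f (x, 3 - t)) := rfl

/-- On the annulus `𝕊 1 × [1, 2]` a concordance takes values in the shell `1 ≤ ‖y‖ ≤ 2`. [folklore] -/
theorem norm_mem_Icc {K K' : Knot} {f : (𝕊 1) × ℝ → 𝔼 4} (hf : IsConcordance K K' f)
    (x : 𝕊 1) {t : ℝ} (ht : t ∈ Icc (1 : ℝ) 2) : 1 ≤ ‖f (x, t)‖ ∧ ‖f (x, t)‖ ≤ 2 := by
  obtain ⟨-, -, -, hshell, -, hK, hK'⟩ := hf
  rcases eq_or_lt_of_le ht.1 with h1 | h1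
  · subst h1
    rw [hK, norm_eq_of_mem_sphere]
    norm_num
  rcases eq_or_lt_of_le ht.2 with h2 | h2
  · subst h2
    rw [hK', norm_smul, norm_eq_of_mem_sphere]
    norm_num
  exact ⟨(hshell x t ⟨h1, h2⟩).1.le, (hshell x t ⟨h1, h2⟩).2.le⟩

/-- **The reverse of a concordance from `K` to `K'` is a concordance from `K'` to `K`.**
Fox–Milnor (1966), §1 (concordance is symmetric); Livingston (2005), §2.1. [cite: FoxMilnor1966, §1] -/
theorem reverse_isConcordance {K K' : Knot} {f : (𝕊 1) × ℝ → 𝔼 4} (hf : IsConcordance K K' f) :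
    IsConcordance K' K (reverse f) := by
  have hnorm := norm_mem_Icc hf
  obtain ⟨hsmooth, hinj, himm, hshell, hneat, hK, hK'⟩ := hf
  have hflip_mem : ∀ {t : ℝ}, t ∈ Icc (1 : ℝ) 2 → 3 - t ∈ Icc (1 : ℝ) 2 := fun ht ↦
    ⟨by linarith [ht.2], by linarith [ht.1]⟩
  refine ⟨?_, ?_, ?_, ?_, ?_, ?_, ?_⟩
  · -- smoothness
    exact contDiff_shellInversion.contMDiff.comp (hsmooth.comp contMDiff_timeFlip)
  · -- injectivity on the annulus
    rintro ⟨x, t⟩ ⟨-, ht⟩ ⟨x', t'⟩ ⟨-, ht'⟩ h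
    have h1 := hnorm x (hflip_mem ht)
    have h2 := hnorm x' (hflip_mem ht')
    have h' := congrArg shellInversion h
    rw [reverse_apply, reverse_apply, shellInversion_shellInversion (by linarith [h1.1])
      (by linarith [h1.2]), shellInversion_shellInversion (by linarith [h2.1])
      (by linarith [h2.2])] at h'
    have := hinj ⟨mem_univ _, hflip_mem ht⟩ ⟨mem_univ _, hflip_mem ht'⟩ h'
    simp only [Prod.mk.injEq] at this
    obtain ⟨rfl, htt⟩ := this
    simp only [Prod.mk.injEq, true_and]
    linarith
  · -- immersion on the annulus
    rintro ⟨x, t⟩ ⟨-, ht⟩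
    have h1 := hnorm x (hflip_mem ht)
    have hdflip : MDifferentiableAt ((𝓡 1).prod 𝓘(ℝ, ℝ)) ((𝓡 1).prod 𝓘(ℝ, ℝ)) timeFlip (x, t) :=
      contMDiff_timeFlip.mdifferentiableAt (by simp)
    have hdf : MDifferentiableAt ((𝓡 1).prod 𝓘(ℝ, ℝ)) 𝓘(ℝ, 𝔼 4) f (timeFlip (x, t)) :=
      hsmooth.mdifferentiableAt (by simp)
    have hdS : MDifferentiableAt 𝓘(ℝ, 𝔼 4) 𝓘(ℝ, 𝔼 4) shellInversion ((f ∘ timeFlip) (x, t)) :=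
      contDiff_shellInversion.contMDiff.mdifferentiableAt (by simp)
    rw [reverse, mfderiv_comp _ hdS (hdf.comp _ hdflip), mfderiv_comp _ hdf hdflip,
      mfderiv_eq_fderiv]
    exact (fderiv_shellInversion_injective h1.1 h1.2).comp
      ((himm _ ⟨mem_univ _, hflip_mem ht⟩).comp (mfderiv_timeFlip_injective _))
  · -- the open annulus goes into the open shell
    intro x t ht
    have ht' : 3 - t ∈ Ioo (1 : ℝ) 2 := ⟨by linarith [ht.2], by linarith [ht.1]⟩
    obtain ⟨hl, hu⟩ := hshell x (3 - t) ht'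
    have h0 : 0 < ‖f (x, 3 - t)‖ := by linarith
    rw [reverse_apply, norm_shellInversion (by linarith)]
    exact ⟨by rw [lt_div_iff₀ h0]; linarith, by rw [div_lt_iff₀ h0]; linarith⟩
  · -- neatness at both ends
    intro x
    -- the radial function of `f` along the `t`-line through `x`
    set h : ℝ → ℝ := fun s ↦ ‖f (x, s)‖ ^ 2 with h_def
    have hcurve : ContMDiff 𝓘(ℝ, ℝ) 𝓘(ℝ, 𝔼 4) ∞ fun s : ℝ ↦ f (x, s) :=
      hsmooth.comp (contMDiff_const.prodMk contMDiff_id)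
    have hcurve' : Differentiable ℝ fun s : ℝ ↦ f (x, s) :=
      (contMDiff_iff_contDiff.1 hcurve).differentiable (by simp)
    have hdiff : Differentiable ℝ h := hcurve'.norm_sq ℝ
    have hh : ∀ s, HasDerivAt h (deriv h s) s := fun s ↦ (hdiff s).hasDerivAt
    -- near `t₀ ∈ {1, 2}` the radial function of `reverse f` is `4 / h (3 - t)`
    have hev : ∀ t₀ : ℝ, 1 ≤ ‖f (x, 3 - t₀)‖ →
        (fun t ↦ ‖reverse f (x, t)‖ ^ 2) =ᶠ[𝓝 t₀] fun t ↦ 4 * (h (3 - t))⁻¹ := by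
      intro t₀ ht₀
      have hc : ContinuousAt (fun t : ℝ ↦ ‖f (x, 3 - t)‖) t₀ :=
        ((hcurve'.continuous.comp (continuous_const.sub continuous_id)).norm).continuousAt
      have : ∀ᶠ t in 𝓝 t₀, 1 / 2 < ‖f (x, 3 - t)‖ :=
        hc.eventually (lt_mem_nhds (by linarith))
      filter_upwards [this] with t ht
      rw [reverse_apply, norm_shellInversion ht.le, div_pow, div_eq_mul_inv]
      norm_num [h_def]
    have hder : ∀ t₀ : ℝ, 1 ≤ ‖f (x, 3 - t₀)‖ →
        deriv (fun t ↦ ‖reverse f (x, t)‖ ^ 2) t₀ =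
          4 * (-(deriv h (3 - t₀) * -1) / h (3 - t₀) ^ 2) := by
      intro t₀ ht₀
      rw [(hev t₀ ht₀).deriv_eq]
      have hne : h (3 - t₀) ≠ 0 := by
        simp only [h_def]
        positivity
      have hcomp : HasDerivAt (fun t ↦ h (3 - t)) (deriv h (3 - t₀) * -1) t₀ :=
        (hh (3 - t₀)).comp t₀ ((hasDerivAt_id t₀).const_sub 3)
      exact ((hcomp.inv hne).const_mul 4).deriv
    have e1 : (3 : ℝ) - 1 = 2 := by norm_num
    have e2 : (3 : ℝ) - 2 = 1 := by norm_num
    have n1 : ‖f (x, 1)‖ = 1 := by rw [hK, norm_eq_of_mem_sphere]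
    have n2 : ‖f (x, 2)‖ = 2 := by rw [hK', norm_smul, norm_eq_of_mem_sphere]; norm_num
    obtain ⟨hd1, hd2⟩ := hneat x
    constructor
    · rw [hder 1 (by rw [e1, n2]; norm_num), e1]
      have : h 2 = 4 := by simp only [h_def, n2]; norm_num
      rw [this]
      nlinarith
    · rw [hder 2 (by rw [e2, n1]), e2]
      have : h 1 = 1 := by simp only [h_def, n1]; norm_num
      rw [this]
      nlinarith
  · -- `reverse f (x, 1) = K' x`
    intro x
    have n2 : ‖f (x, 2)‖ = 2 := by rw [hK', norm_smul, norm_eq_of_mem_sphere]; norm_num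
    rw [reverse_apply, show (3 : ℝ) - 1 = 2 by norm_num, shellInversion_eq (by rw [n2]; norm_num),
      n2, hK', smul_smul]
    conv_rhs => rw [← one_smul ℝ (K' x : 𝔼 4)]
    congr 1
    norm_num
  · -- `reverse f (x, 2) = 2 • K x`
    intro x
    have n1 : ‖f (x, 1)‖ = 1 := by rw [hK, norm_eq_of_mem_sphere]
    rw [reverse_apply, show (3 : ℝ) - 2 = 1 by norm_num, shellInversion_eq (by rw [n1]; norm_num),
      n1, hK]
    norm_num

end IsConcordance

/-- **Concordance is symmetric**: the reverse (`IsConcordance.reverse`: time flip composed with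
the inversion of the shell) of a concordance from `K` to `K'` is a concordance from `K'` to `K`.
Fox–Milnor (1966), §1; Livingston (2005), §1 (Introduction: concordance is an equivalence
relation) and §2.1. [cite: FoxMilnor1966, §1] -/
theorem IsConcordant.swap {K K' : Knot} (h : K.IsConcordant K') : K'.IsConcordant K := by
  obtain ⟨f, hf⟩ := h
  exact ⟨IsConcordance.reverse f, hf.reverse_isConcordance⟩

/-- Concordance is a symmetric relation (both directions of `IsConcordant.swap`).
Fox–Milnor (1966), §1. [cite: FoxMilnor1966, §1] -/
theorem isConcordant_comm {K K' : Knot} : K.IsConcordant K' ↔ K'.IsConcordant K :=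
  ⟨IsConcordant.swap, IsConcordant.swap⟩

/-! ## Slice surfaces radial near the boundary, and the gluing decomposition -/

/-- `K` **bounds a slice surface of genus `g` which is radial near its boundary**: the data of
`HasSliceSurfaceOfGenus K g` (a compact connected orientable surface `S` with one boundary circle,
a smooth injective immersion `F : S → B⁴` with `F = K ∘ e` on `∂S` and `F (int S) ⊂ int B⁴`)
together with a width `δ > 0` and an angular map `π : S → 𝕊 1`, smooth on the *radial band*
`{p | 1 - δ < ‖F p‖}`, such that `F p = ‖F p‖ • K (π p)` on that band: near `∂B⁴` the surface is
the cone on `K`, i.e. vertical for the radial collar of `𝕊 3` in `B⁴`.  (`π` is determined by `F`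
since `K` is injective, and its smoothness follows from that of `F` since `K` is an immersion; it
is recorded to spare consumers this derivation.)  This is the normal form near the boundary
provided by the collaring theorems, Hirsch (1976), Ch. 4 §6, Thms. 6.1–6.2; Kosinski (1993),
II (2.8.2). [cite: HirschDT1976, Ch. 4 §6 Thm. 6.2] -/
def HasRadialSliceSurfaceOfGenus (K : Knot) (g : ℕ) : Prop :=
  ∃ (S : Type) (_ : TopologicalSpace S) (_ : T2Space S) (_ : SecondCountableTopology S)
    (_ : CompactSpace S) (_ : ConnectedSpace S) (_ : ChartedSpace (EuclideanHalfSpace 2) S)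
    (_ : IsManifold (𝓡∂ 2) ∞ S) (F : S → 𝔼 4) (e : ↥((𝓡∂ 2).boundary S) ≃ₜ ↥(𝕊 1)),
    K.IsSpanningSurfaceOfGenus F e g ∧ (∀ x ∈ (𝓡∂ 2).interior S, ‖F x‖ < 1) ∧
    ∃ (δ : ℝ) (π : S → 𝕊 1), 0 < δ ∧
      ContMDiffOn (𝓡∂ 2) (𝓡 1) ∞ π {p | 1 - δ < ‖F p‖} ∧
      ∀ p, 1 - δ < ‖F p‖ → F p = ‖F p‖ • ((K (π p) : 𝕊 3) : 𝔼 4)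

/-- A radial slice surface is in particular a slice surface. [folklore] -/
theorem HasRadialSliceSurfaceOfGenus.hasSliceSurfaceOfGenus {K : Knot} {g : ℕ}
    (h : K.HasRadialSliceSurfaceOfGenus g) : K.HasSliceSurfaceOfGenus g := by
  obtain ⟨S, i₁, i₂, i₃, i₄, i₅, i₆, i₇, F, e, hF, hint, -⟩ := h
  exact ⟨S, i₁, i₂, i₃, i₄, i₅, i₆, i₇, F, e, hF, hint⟩

/-- **Fact A (straightening a slice surface near its boundary).** If `K` bounds a slice surface
of genus `g` in `B⁴`, it bounds one of genus `g` which is radial near its boundary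
(`HasRadialSliceSurfaceOfGenus`).  Mechanism: after a `C¹`-small perturbation supported near
`∂S` the surface meets `𝕊 3` transversally (embeddings are `C¹`-open, Hirsch 1976, Ch. 2
Thm. 1.4); a neat surface lies vertically in some collar of `𝕊 3` in `B⁴` (Hirsch 1976, Ch. 4 §6,
Thm. 6.2; Kosinski 1993, II (2.8.2)), and any collar of `𝕊 3` is ambient isotopic to the radial
one (uniqueness of collars, Kosinski 1993, III (3.3)).  Not printed in this form: it is the
standard normalisation (the surface may be assumed to be a product near the boundary) implicit in
the invariance of `g₄` asserted by Livingston (2005), §9.5; the cite points at the collaring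
theorem that drives it. Vendored as a named fact (D-0014). [cite: HirschDT1976, Ch. 4 §6 Thm. 6.2] -/
def HasSliceSurfaceOfGenus.exists_radial : Prop :=
  ∀ {K : Knot} {g : ℕ} (_h : K.HasSliceSurfaceOfGenus g), K.HasRadialSliceSurfaceOfGenus g

/-- **Fact B (straightening a concordance near its inner end).** Every concordance class of
annuli from `K` to `K'` contains one which is radial near `t = 1`: `f (x, t) = t • K x` for
`t ∈ [1, 1 + δ]`, some `δ > 0`.  Mechanism: an `Literature` concordance is neat at `t = 1` (the radial
derivative of `‖f‖²` is positive), so near `𝕊 3 × {1}` it can be reparametrised to be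
level-preserving (inverse function theorem with parameters) and then its angular part can be
frozen near `t = 1` by a cut-off in `t`; equivalently, a neat submanifold is vertical in a suitable
collar (Kosinski 1993, II (2.8.2); Hirsch 1976, Ch. 4 §6, Thm. 6.2) and collars are unique up to
ambient isotopy (Kosinski 1993, III (3.3)).  Not printed in this form (implicit in Livingston
2005, §9.5); the cite points at the collaring theorem that drives it. Vendored as a named fact
(D-0014). [cite: HirschDT1976, Ch. 4 §6 Thm. 6.2] -/
def IsConcordant.exists_radial : Prop :=
  ∀ {K K' : Knot} (_h : K.IsConcordant K'),
    ∃ f, IsConcordance K K' f ∧ ∃ δ : ℝ, 0 < δ ∧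
      ∀ x : 𝕊 1, ∀ t ∈ Icc (1 : ℝ) (1 + δ), f (x, t) = t • ((K x : 𝕊 3) : 𝔼 4)

/-- **Fact C (gluing a radial slice surface to a radial concordance).** Let `K` bound a slice
surface `F : S → B⁴` of genus `g` radial near its boundary, and let `f` be a concordance from `K`
to `K'` with `f (x, t) = t • K x` for `t ∈ [1, 1 + δ]`.  Then `K'` bounds a slice surface of genus
`g`: the union of `F(S) ⊂ B⁴` and of the annulus `f(𝕊 1 × [1, 2])` in the shell is a smooth
surface in `2 • B⁴` with boundary `2 • K'` (the two pieces fit along the cone on `K`), and half of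
it is a slice surface for `K'`; it is parametrised by the same abstract surface `S`
(reparametrise the radial band `1 - δ < ‖F p‖ ≤ 1` of `S` over band ∪ annulus), so genus,
orientability and the boundary circle are unchanged.  This is the gluing `M₁ ∪_h M₂` of
Kosinski (1993), VI §5 / Hirsch (1976), Ch. 8 §2 in the present embedded setting, i.e. the
gluing step (concordance annulus ∪ slice surface is a slice surface of the same genus in
`S³ × I ∪ B⁴ ≅ B⁴`) implicit in the invariance of `g₄` asserted by Livingston (2005), §9.5.
Vendored as a named fact (D-0014); discharged below (`glue_holds`). [cite: Livingston2005, §9.5] -/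
def HasRadialSliceSurfaceOfGenus.glue : Prop :=
  ∀ {K K' : Knot} {g : ℕ} (_hK : K.HasRadialSliceSurfaceOfGenus g) {f : (𝕊 1) × ℝ → 𝔼 4}
    (_hf : IsConcordance K K' f) {δ : ℝ} (_hδ : 0 < δ)
    (_hrad : ∀ x : 𝕊 1, ∀ t ∈ Icc (1 : ℝ) (1 + δ), f (x, t) = t • ((K x : 𝕊 3) : 𝔼 4)),
    K'.HasSliceSurfaceOfGenus g

/-- **Slice surfaces transfer along concordances** (given facts A, B, C): if `K` is concordant
to `K'` and bounds a slice surface of genus `g`, so does `K'`.  This is the inequality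
`g₄(K') ≤ g₄(K)` of Livingston (2005), §9.5. [cite: Livingston2005, §9.5] -/
theorem HasSliceSurfaceOfGenus.of_isConcordant_of_facts
    (hA : HasSliceSurfaceOfGenus.exists_radial) (hB : IsConcordant.exists_radial)
    (hC : HasRadialSliceSurfaceOfGenus.glue) {K K' : Knot} {g : ℕ} (h : K.IsConcordant K')
    (hK : K.HasSliceSurfaceOfGenus g) : K'.HasSliceSurfaceOfGenus g := by
  obtain ⟨f, hf, δ, hδ, hrad⟩ := hB h
  exact hC (hA hK) hf hδ hrad

/-- **Concordant knots bound slice surfaces of the same genera** (given facts A, B, C; the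
reverse inclusion uses the proved symmetry `IsConcordant.swap`). Livingston (2005), §9.5. [cite: Livingston2005, §9.5] -/
theorem hasSliceSurfaceOfGenus_iff_of_isConcordant_of_facts
    (hA : HasSliceSurfaceOfGenus.exists_radial) (hB : IsConcordant.exists_radial)
    (hC : HasRadialSliceSurfaceOfGenus.glue) {K K' : Knot} {g : ℕ} (h : K.IsConcordant K') :
    K.HasSliceSurfaceOfGenus g ↔ K'.HasSliceSurfaceOfGenus g :=
  ⟨HasSliceSurfaceOfGenus.of_isConcordant_of_facts hA hB hC h,
    HasSliceSurfaceOfGenus.of_isConcordant_of_facts hA hB hC h.swap⟩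

/-- **Assembly: the slice genus is a concordance invariant, given facts A, B, C.**  The sets of
genera of slice surfaces of two concordant knots coincide, hence so do their infima `sliceGenus`
(no non-emptiness needed).  Discharges `IsConcordant.sliceGenus_eq` of `SliceGenus` once
`exists_radial`, `IsConcordant.exists_radial` and `glue` are proved. Livingston (2005), §9.5
("[g₄] is a concordance invariant"). [cite: Livingston2005, §9.5] -/
theorem IsConcordant.sliceGenus_eq_of_facts
    (hA : HasSliceSurfaceOfGenus.exists_radial) (hB : IsConcordant.exists_radial)
    (hC : HasRadialSliceSurfaceOfGenus.glue) : IsConcordant.sliceGenus_eq := by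
  intro K K' h
  unfold sliceGenus
  congr 1
  ext g
  exact hasSliceSurfaceOfGenus_iff_of_isConcordant_of_facts hA hB hC h


/-! ## Proof of fact C: gluing a radial slice surface to a radial concordance -/

namespace Glue

/-!
### Auxiliary functions

The glued surface is parametrised by the original abstract surface `S`: a point `p` with
`‖F p‖ = r` in the radial band is sent to "time" `T = 2 r ϑ(r²)` along the ray (resp. the
annulus) through `K (π p)`, where the profile `ϑ = profile s₁` increases from `1/2` (for
`r² ≤ s₁`, where nothing moves up to the global factor `1/2`) to `1` (on `∂S`, which goes to
time `2`, the outer end of the concordance).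
-/

variable {s₁ : ℝ}

/-- The radial profile `ϑ(s) = 1/2 + smoothTransition((s - s₁)/(1 - s₁))/2`: smooth, monotone,
equal to `1/2` for `s ≤ s₁` and to `1` for `s ≥ 1` (when `s₁ < 1`). Auxiliary for fact C. [folklore] -/
def profile (s₁ s : ℝ) : ℝ :=
  1 / 2 + 1 / 2 * Real.smoothTransition ((s - s₁) / (1 - s₁))

/-- `1/2 ≤ ϑ`. [folklore] -/
theorem half_le_profile (s : ℝ) : 1 / 2 ≤ profile s₁ s := by
  unfold profile
  linarith [Real.smoothTransition.nonneg ((s - s₁) / (1 - s₁))]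

/-- `ϑ ≤ 1`. [folklore] -/
theorem profile_le_one (s : ℝ) : profile s₁ s ≤ 1 := by
  unfold profile
  linarith [Real.smoothTransition.le_one ((s - s₁) / (1 - s₁))]

/-- `0 < ϑ`. [folklore] -/
theorem profile_pos (s : ℝ) : 0 < profile s₁ s := by
  linarith [half_le_profile (s₁ := s₁) s]

/-- `ϑ(s) = 1/2` for `s ≤ s₁ < 1`. [folklore] -/
theorem profile_of_le (hs₁ : s₁ < 1) {s : ℝ} (hs : s ≤ s₁) : profile s₁ s = 1 / 2 := by
  unfold profile
  rw [Real.smoothTransition.zero_of_nonpos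
    (div_nonpos_of_nonpos_of_nonneg (by linarith) (by linarith))]
  ring

/-- `ϑ(s) = 1` for `s ≥ 1 > s₁`. [folklore] -/
theorem profile_of_one_le (hs₁ : s₁ < 1) {s : ℝ} (hs : 1 ≤ s) : profile s₁ s = 1 := by
  unfold profile
  rw [Real.smoothTransition.one_of_one_le ((one_le_div (by linarith)).2 (by linarith))]
  ring

/-- `ϑ` is monotone (for `s₁ < 1`). [folklore] -/
theorem monotone_profile (hs₁ : s₁ < 1) : Monotone (profile s₁) := by
  intro a b hab
  unfold profile
  have : (a - s₁) / (1 - s₁) ≤ (b - s₁) / (1 - s₁) :=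
    div_le_div_of_nonneg_right (by linarith) (by linarith)
  linarith [Real.smoothTransition.monotone this]

/-- `ϑ` is `C^∞`. [folklore] -/
theorem contDiff_profile : ContDiff ℝ ∞ (profile s₁) := by
  unfold profile
  exact contDiff_const.add (contDiff_const.mul (Real.smoothTransition.contDiff.comp
    ((contDiff_id.sub contDiff_const).div_const _)))

/-- `ϑ` is continuous. [folklore] -/
theorem continuous_profile : Continuous (profile s₁) :=
  contDiff_profile.continuous

/-- `ϑ' ≥ 0`. [folklore] -/
theorem deriv_profile_nonneg (hs₁ : s₁ < 1) (s : ℝ) : 0 ≤ deriv (profile s₁) s :=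
  (monotone_profile hs₁).deriv_nonneg

/-- `ϑ` is differentiable. [folklore] -/
theorem hasDerivAt_profile (s : ℝ) : HasDerivAt (profile s₁) (deriv (profile s₁) s) s :=
  ((contDiff_profile.differentiable (by simp)) s).hasDerivAt

/-- Strict monotonicity of the radial time profile `r ↦ ϑ(r²) r` on `r ≥ 0`. [folklore] -/
theorem profile_sq_mul_lt (hs₁ : s₁ < 1) {r r' : ℝ} (hr : 0 ≤ r) (h : r < r') :
    profile s₁ (r ^ 2) * r < profile s₁ (r' ^ 2) * r' := by
  have hm : profile s₁ (r ^ 2) ≤ profile s₁ (r' ^ 2) := monotone_profile hs₁ (by nlinarith)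
  calc profile s₁ (r ^ 2) * r ≤ profile s₁ (r' ^ 2) * r := mul_le_mul_of_nonneg_right hm hr
    _ < profile s₁ (r' ^ 2) * r' := mul_lt_mul_of_pos_left h (profile_pos _)

/-- Injectivity of the radial time profile on `r ≥ 0`. [folklore] -/
theorem eq_of_profile_sq_mul_eq (hs₁ : s₁ < 1) {r r' : ℝ} (hr : 0 ≤ r) (hr' : 0 ≤ r')
    (h : profile s₁ (r ^ 2) * r = profile s₁ (r' ^ 2) * r') : r = r' := by
  rcases lt_trichotomy r r' with hlt | heq | hgt
  · exact absurd h (profile_sq_mul_lt hs₁ hr hlt).ne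
  · exact heq
  · exact absurd h (profile_sq_mul_lt hs₁ hr' hgt).ne'

/-- The **radial reparametrisation** `Θ(y) = ϑ(‖y‖²) • y` of `ℝ⁴`. Auxiliary for fact C. [folklore] -/
def radialMap (s₁ : ℝ) (y : 𝔼 4) : 𝔼 4 :=
  profile s₁ (‖y‖ ^ 2) • y

/-- `Θ` is `C^∞`. [folklore] -/
theorem contDiff_radialMap : ContDiff ℝ ∞ (radialMap s₁) :=
  (contDiff_profile.comp (contDiff_norm_sq ℝ)).smul contDiff_id

/-- `‖Θ y‖ = ϑ(‖y‖²) ‖y‖`. [folklore] -/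
theorem norm_radialMap (y : 𝔼 4) : ‖radialMap s₁ y‖ = profile s₁ (‖y‖ ^ 2) * ‖y‖ := by
  rw [radialMap, norm_smul, Real.norm_of_nonneg (profile_pos _).le]

/-- `Θ` is injective (its radial profile is strictly monotone). [folklore] -/
theorem radialMap_injective (hs₁ : s₁ < 1) : Injective (radialMap s₁) := by
  intro y y' h
  have hn : ‖y‖ = ‖y'‖ := by
    have := congrArg norm h
    rw [norm_radialMap, norm_radialMap] at this
    exact eq_of_profile_sq_mul_eq hs₁ (norm_nonneg _) (norm_nonneg _) this
  unfold radialMap at h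
  rw [hn] at h
  exact smul_right_injective _ (profile_pos _).ne' h

/-- The derivative of `Θ` at `y` is `v ↦ ϑ(‖y‖²) v + 2 ϑ'(‖y‖²) ⟪y, v⟫ y`. [folklore] -/
theorem hasFDerivAt_radialMap (y : 𝔼 4) :
    ∃ L : 𝔼 4 →L[ℝ] 𝔼 4, HasFDerivAt (radialMap s₁) L y ∧
      ∀ v, L v = profile s₁ (‖y‖ ^ 2) • v +
        (deriv (profile s₁) (‖y‖ ^ 2) * (2 * inner ℝ y v)) • y := by
  have h1 := (hasDerivAt_profile (s₁ := s₁) (‖y‖ ^ 2)).comp_hasFDerivAt y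
    (hasStrictFDerivAt_norm_sq y).hasFDerivAt
  refine ⟨_, h1.smul (hasFDerivAt_id y), fun v ↦ ?_⟩
  simp only [_root_.add_apply, _root_.smul_apply,
    ContinuousLinearMap.id_apply, ContinuousLinearMap.smulRight_apply, innerSL_apply_apply,
    smul_eq_mul, nsmul_eq_mul, Nat.cast_ofNat, comp_apply]

/-- A linear map of the form `v ↦ a v + 2 b ⟪y, v⟫ y` with `a > 0`, `b ≥ 0` is injective. [folklore] -/
theorem injective_of_radial_formula {y : 𝔼 4} {a b : ℝ} (ha : 0 < a) (hb : 0 ≤ b)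
    (L : 𝔼 4 →L[ℝ] 𝔼 4) (hL : ∀ v, L v = a • v + (b * (2 * inner ℝ y v)) • y) :
    Injective L := by
  intro v w hvw
  have h0 : L (v - w) = 0 := by rw [map_sub, hvw, sub_self]
  rw [hL] at h0
  have h1 : inner ℝ y (a • (v - w) + (b * (2 * inner ℝ y (v - w))) • y) = 0 := by
    rw [h0, inner_zero_right]
  rw [inner_add_right, inner_smul_right, inner_smul_right, real_inner_self_eq_norm_sq] at h1
  have h2 : inner ℝ y (v - w) = 0 := by
    have h3 : inner ℝ y (v - w) * (a + 2 * b * ‖y‖ ^ 2) = 0 := by linarith [h1]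
    rcases mul_eq_zero.1 h3 with h | h
    · exact h
    · nlinarith [mul_nonneg hb (sq_nonneg ‖y‖)]
  rw [h2, mul_zero, mul_zero, zero_smul, add_zero] at h0
  exact sub_eq_zero.1 ((smul_eq_zero_iff_right ha.ne').1 h0)

/-- The derivative of `Θ` is injective at every point (for `s₁ < 1`). [folklore] -/
theorem fderiv_radialMap_injective (hs₁ : s₁ < 1) (y : 𝔼 4) :
    Injective (fderiv ℝ (radialMap s₁) y) := by
  obtain ⟨L, hL, hLv⟩ := hasFDerivAt_radialMap (s₁ := s₁) y
  rw [hL.fderiv]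
  exact injective_of_radial_formula (profile_pos _) (deriv_profile_nonneg hs₁ _) L hLv

/-- The **time function** `T(y) = 2 ϑ(‖y‖²) ‖y‖ = 2 ‖Θ y‖`. Auxiliary for fact C. [folklore] -/
def timeFn (s₁ : ℝ) (y : 𝔼 4) : ℝ :=
  2 * (profile s₁ (‖y‖ ^ 2) * ‖y‖)

/-- `T` is continuous. [folklore] -/
theorem continuous_timeFn : Continuous (timeFn s₁) := by
  unfold timeFn
  exact continuous_const.mul
    ((continuous_profile.comp (continuous_norm.pow 2)).mul continuous_norm)

/-- `T` is `C^∞` away from the origin. [folklore] -/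
theorem contDiffAt_timeFn {y : 𝔼 4} (hy : y ≠ 0) : ContDiffAt ℝ ∞ (timeFn s₁) y := by
  unfold timeFn
  exact contDiffAt_const.mul
    (((contDiff_profile.comp (contDiff_norm_sq ℝ)).contDiffAt).mul (contDiffAt_norm ℝ hy))

/-- `T y ≤ 2` on the closed unit ball. [folklore] -/
theorem timeFn_le_two {y : 𝔼 4} (hy : ‖y‖ ≤ 1) : timeFn s₁ y ≤ 2 := by
  unfold timeFn
  nlinarith [norm_nonneg y, profile_pos (s₁ := s₁) (‖y‖ ^ 2),
    profile_le_one (s₁ := s₁) (‖y‖ ^ 2)]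

/-- `T y = 2` on the unit sphere. [folklore] -/
theorem timeFn_of_norm_eq_one (hs₁ : s₁ < 1) {y : 𝔼 4} (hy : ‖y‖ = 1) : timeFn s₁ y = 2 := by
  unfold timeFn
  rw [hy, one_pow, profile_of_one_le hs₁ le_rfl]
  norm_num

/-- `T y < 2` on the open unit ball. [folklore] -/
theorem timeFn_lt_two (hs₁ : s₁ < 1) {y : 𝔼 4} (hy : ‖y‖ < 1) : timeFn s₁ y < 2 := by
  unfold timeFn
  have := profile_sq_mul_lt hs₁ (norm_nonneg y) hy
  rw [one_pow, profile_of_one_le hs₁ le_rfl, mul_one] at this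
  linarith

/-- `T y = ‖y‖` for `‖y‖² ≤ s₁`. [folklore] -/
theorem timeFn_eq_norm (hs₁ : s₁ < 1) {y : 𝔼 4} (hy : ‖y‖ ^ 2 ≤ s₁) : timeFn s₁ y = ‖y‖ := by
  unfold timeFn
  rw [profile_of_le hs₁ hy]
  ring

/-- `T y > 1` forces `‖y‖² > s₁`. [folklore] -/
theorem lt_sq_of_one_lt_timeFn (hs₁ : s₁ < 1) {y : 𝔼 4} (h : 1 < timeFn s₁ y) :
    s₁ < ‖y‖ ^ 2 := by
  by_contra hle
  rw [not_lt] at hle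
  rw [timeFn_eq_norm hs₁ hle] at h
  nlinarith [norm_nonneg y]

/-- `T` determines the norm. [folklore] -/
theorem norm_eq_of_timeFn_eq (hs₁ : s₁ < 1) {y y' : 𝔼 4} (h : timeFn s₁ y = timeFn s₁ y') :
    ‖y‖ = ‖y'‖ :=
  eq_of_profile_sq_mul_eq hs₁ (norm_nonneg _) (norm_nonneg _) (by unfold timeFn at h; linarith)

/-- `‖Θ y‖ = T y / 2`. [folklore] -/
theorem norm_radialMap_eq (y : 𝔼 4) : ‖radialMap s₁ y‖ = timeFn s₁ y / 2 := by
  rw [norm_radialMap, timeFn]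
  ring

/-- The **cone** on a knot: `(x, t) ↦ t • K x`, `𝕊 1 × ℝ → ℝ⁴`. Auxiliary for fact C. [folklore] -/
def cone (K : Knot) (q : (𝕊 1) × ℝ) : 𝔼 4 :=
  q.2 • ((K q.1 : 𝕊 3) : 𝔼 4)

/-- The cone map is `C^∞`. [folklore] -/
theorem contMDiff_cone (K : Knot) : ContMDiff ((𝓡 1).prod 𝓘(ℝ, ℝ)) 𝓘(ℝ, 𝔼 4) ∞ (cone K) := by
  haveI := Fact.mk (@finrank_euclideanSpace_fin ℝ _ (3 + 1))
  exact contMDiff_snd.smul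
    (((contMDiff_coe_sphere (E := 𝔼 (3 + 1)) (n := 3)).comp K.contMDiff).comp contMDiff_fst)

/-- A continuous linear map which is pointwise a nonzero scalar multiple of an injective one is
injective. [folklore] -/
theorem injective_of_eq_smul {E₁ E₂ : Type*} [TopologicalSpace E₁] [AddCommGroup E₁]
    [Module ℝ E₁] [TopologicalSpace E₂] [AddCommGroup E₂] [Module ℝ E₂] {c : ℝ} (hc : c ≠ 0)
    {L : E₁ →L[ℝ] E₂} (hL : Injective L) (L' : E₁ →L[ℝ] E₂) (hL' : ∀ v, L' v = c • L v) :
    Injective L' := by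
  intro v w h
  apply hL
  rw [hL', hL'] at h
  simpa only [inv_smul_smul₀ hc] using congrArg (fun z ↦ c⁻¹ • z) h

end Glue

open Glue in
/-- **Fact C holds** (`HasRadialSliceSurfaceOfGenus.glue`): a radial slice surface `F : S → B⁴`
of genus `g` for `K` and a concordance `f` from `K` to `K'` with `f (x, t) = t • K x` on
`[1, 1 + δ]` give a slice surface of genus `g` for `K'`, parametrised by the same `S`:
`G p = Θ (F p)` where `T (F p) < 1 + δ` and `G p = ½ f (π p, T (F p))` where `T (F p) > 1`
(the two formulas agree on the overlap because `f` is the cone there and `F` is radial on the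
band).  Smoothness and injectivity of derivatives are read off from the two local formulas
(`Θ` has injective derivative; `cone ∘ (π, T) = 2 Θ ∘ F` controls the derivative of `(π, T)`);
injectivity, the boundary values `K' ∘ e` and `G (int S) ⊂ int B⁴` are norm computations.
The embedded version of the gluing `M₁ ∪_h M₂` of Kosinski (1993), VI §5; the gluing step
implicit in the concordance invariance of `g₄`, Livingston (2005), §9.5. [cite: Livingston2005, §9.5] -/
theorem HasRadialSliceSurfaceOfGenus.glue_holds : HasRadialSliceSurfaceOfGenus.glue := by
  intro K K' g hK f hf δ hδ hrad
  obtain ⟨S, _, _, _, _, _, _, _, F, e, ⟨hor, hFs, hFi, hFimm, hFb, hrank⟩, hint, δS, π, hδS, hπ,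
    hradS⟩ := hK
  have hnorm := IsConcordance.norm_mem_Icc hf
  obtain ⟨hfs, hfinj, hfimm, hshell, -, -, hfK'⟩ := hf
  -- parameters `δ₀ ≤ min δS (1/2)` and `s₁ = (1 - δ₀/2)²`
  obtain ⟨δ₀, hδ₀, hδ₀S, hδ₀h⟩ : ∃ δ₀ : ℝ, 0 < δ₀ ∧ δ₀ ≤ δS ∧ δ₀ ≤ 1 / 2 :=
    ⟨min δS (1 / 2), lt_min hδS (by norm_num), min_le_left _ _, min_le_right _ _⟩
  obtain ⟨s₁, hs₁, hs₁'⟩ : ∃ s₁ : ℝ, s₁ < 1 ∧ (1 - δ₀) ^ 2 < s₁ :=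
    ⟨(1 - δ₀ / 2) ^ 2, by nlinarith, by nlinarith⟩
  -- norms of `F` and of `f`
  have hFle : ∀ p, ‖F p‖ ≤ 1 := by
    intro p
    by_cases hp : p ∈ (𝓡∂ 2).interior S
    · exact (hint p hp).le
    · have hb : p ∈ (𝓡∂ 2).boundary S := by
        rw [← ModelWithCorners.compl_interior]; exact hp
      rw [show F p = ((K (e ⟨p, hb⟩) : 𝕊 3) : 𝔼 4) from hFb ⟨p, hb⟩, norm_eq_of_mem_sphere]
  have hf1 : ∀ x t, 1 < t → t ≤ 2 → 1 < ‖f (x, t)‖ := by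
    intro x t h1 h2
    rcases eq_or_lt_of_le h2 with rfl | h2
    · rw [hfK', norm_smul, norm_eq_of_mem_sphere]; norm_num
    · exact (hshell x t ⟨h1, h2⟩).1
  have hFcont : Continuous F := hFs.continuous
  -- the time function on `S`
  set T : S → ℝ := fun p ↦ timeFn s₁ (F p) with hT_def
  have hTcont : Continuous T := continuous_timeFn.comp hFcont
  have hTle : ∀ p, T p ≤ 2 := fun p ↦ timeFn_le_two (hFle p)
  have hband : ∀ p, 1 < T p → 1 - δ₀ < ‖F p‖ := by
    intro p hp
    have h := lt_sq_of_one_lt_timeFn hs₁ hp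
    by_contra hle
    rw [not_lt] at hle
    nlinarith [norm_nonneg (F p)]
  have hF0 : ∀ p, 1 < T p → F p ≠ 0 := by
    intro p hp h0
    have := hband p hp
    rw [h0, norm_zero] at this
    linarith
  have hbandS : ∀ p, 1 < T p → p ∈ {q | 1 - δS < ‖F q‖} := fun p hp ↦ by
    simp only [mem_setOf_eq]; linarith [hband p hp]
  have hradS' : ∀ p, 1 < T p → F p = ‖F p‖ • ((K (π p) : 𝕊 3) : 𝔼 4) := fun p hp ↦
    hradS p (hbandS p hp)
  -- on `{T > 1}`, the cone through `(π, T)` is `2 Θ ∘ F`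
  have hcone : ∀ p, 1 < T p → cone K (π p, T p) = (2 : ℝ) • radialMap s₁ (F p) := by
    intro p hp
    calc cone K (π p, T p) = (2 * profile s₁ (‖F p‖ ^ 2)) • (‖F p‖ • ((K (π p) : 𝕊 3) : 𝔼 4)) := by
          rw [smul_smul, mul_assoc]; rfl
      _ = (2 * profile s₁ (‖F p‖ ^ 2)) • F p := by rw [← hradS' p hp]
      _ = (2 : ℝ) • radialMap s₁ (F p) := by rw [radialMap, smul_smul]
  -- the glued map
  set Ψ : S → (𝕊 1) × ℝ := fun p ↦ (π p, T p) with hΨ_def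
  set G : S → 𝔼 4 := fun p ↦ if T p ≤ 1 + δ / 2 then radialMap s₁ (F p)
    else (1 / 2 : ℝ) • f (π p, T p) with hG_def
  have hG1 : ∀ p, T p < 1 + δ → G p = radialMap s₁ (F p) := by
    intro p hp
    simp only [hG_def]
    split_ifs with h
    · rfl
    · have h := lt_of_not_ge h
      have h1 : 1 < T p := by linarith
      have h2 := hcone p h1
      simp only [cone] at h2
      rw [hrad (π p) (T p) ⟨h1.le, hp.le⟩, h2, smul_smul]
      norm_num
  have hG2 : ∀ p, 1 < T p → G p = (1 / 2 : ℝ) • f (π p, T p) := by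
    intro p hp
    simp only [hG_def]
    split_ifs with h
    · have h2 := hcone p hp
      simp only [cone] at h2
      rw [hrad (π p) (T p) ⟨hp.le, by linarith⟩, h2, smul_smul]
      norm_num
    · rfl
  have hO1 : IsOpen {p | T p < 1 + δ} := isOpen_lt hTcont continuous_const
  have hO2 : IsOpen {p | 1 < T p} := isOpen_lt continuous_const hTcont
  have hG1ev : ∀ p, T p < 1 + δ → G =ᶠ[𝓝 p] (radialMap s₁ ∘ F) := fun p hp ↦ by
    filter_upwards [hO1.mem_nhds hp] with q hq using hG1 q hq
  have hG2ev : ∀ p, 1 < T p → G =ᶠ[𝓝 p] ((1 / 2 : ℝ) • (f ∘ Ψ)) := fun p hp ↦ by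
    filter_upwards [hO2.mem_nhds hp] with q hq using hG2 q hq
  have hconeev : ∀ p, 1 < T p → (cone K ∘ Ψ) =ᶠ[𝓝 p] ((2 : ℝ) • (radialMap s₁ ∘ F)) :=
    fun p hp ↦ by
    filter_upwards [hO2.mem_nhds hp] with q hq
    simp only [comp_apply, Pi.smul_apply]
    exact hcone q hq
  -- smoothness of the pieces
  have hΘF : ContMDiff (𝓡∂ 2) 𝓘(ℝ, 𝔼 4) ∞ (radialMap s₁ ∘ F) :=
    contDiff_radialMap.comp_contMDiff hFs
  have hΨs : ∀ p, 1 < T p → ContMDiffAt (𝓡∂ 2) ((𝓡 1).prod 𝓘(ℝ, ℝ)) ∞ Ψ p := by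
    intro p hp
    have hπp : ContMDiffAt (𝓡∂ 2) (𝓡 1) ∞ π p :=
      hπ.contMDiffAt ((isOpen_lt continuous_const (continuous_norm.comp hFcont)).mem_nhds
        (hbandS p hp))
    have hTp : ContMDiffAt (𝓡∂ 2) 𝓘(ℝ, ℝ) ∞ T p :=
      (contDiffAt_timeFn (hF0 p hp)).comp_contMDiffAt hFs.contMDiffAt
    exact hπp.prodMk hTp
  have hfΨ : ∀ p, 1 < T p → ContMDiffAt (𝓡∂ 2) 𝓘(ℝ, 𝔼 4) ∞ ((1 / 2 : ℝ) • (f ∘ Ψ)) p := by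
    intro p hp
    exact (contMDiffAt_const (c := (1 / 2 : ℝ)) (I' := 𝓘(ℝ, ℝ))).smul
      (hfs.contMDiffAt.comp p (hΨs p hp))
  -- differentiability facts
  have hdF : ∀ p, MDifferentiableAt (𝓡∂ 2) 𝓘(ℝ, 𝔼 4) F p := fun p ↦
    hFs.mdifferentiableAt (by simp)
  have hdΘ : ∀ y, MDifferentiableAt 𝓘(ℝ, 𝔼 4) 𝓘(ℝ, 𝔼 4) (radialMap s₁) y := fun y ↦
    contDiff_radialMap.contMDiff.mdifferentiableAt (by simp)
  have hdf : ∀ q, MDifferentiableAt ((𝓡 1).prod 𝓘(ℝ, ℝ)) 𝓘(ℝ, 𝔼 4) f q := fun q ↦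
    hfs.mdifferentiableAt (by simp)
  have hdcone : ∀ q, MDifferentiableAt ((𝓡 1).prod 𝓘(ℝ, ℝ)) 𝓘(ℝ, 𝔼 4) (cone K) q := fun q ↦
    (contMDiff_cone K).mdifferentiableAt (by simp)
  have hΘFinj : ∀ p, Injective
      ((mfderiv 𝓘(ℝ, 𝔼 4) 𝓘(ℝ, 𝔼 4) (radialMap s₁) (F p)).comp (mfderiv (𝓡∂ 2) 𝓘(ℝ, 𝔼 4) F p)) :=
    fun p ↦ by
    rw [mfderiv_eq_fderiv]
    exact (fderiv_radialMap_injective hs₁ (F p)).comp (hFimm p)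
  -- assemble the slice surface for `K'`
  refine ⟨S, inferInstance, inferInstance, inferInstance, inferInstance, inferInstance,
    inferInstance, inferInstance, G, e, ⟨hor, ?_, ?_, ?_, ?_, hrank⟩, ?_⟩
  · -- smoothness
    intro p
    rcases lt_or_ge (T p) (1 + δ) with hp | hp
    · exact (hΘF p).congr_of_eventuallyEq (hG1ev p hp)
    · have hp1 : 1 < T p := by linarith
      exact (hfΨ p hp1).congr_of_eventuallyEq (hG2ev p hp1)
  · -- injectivity
    intro p q hpq
    have hnG1 : ∀ p, T p ≤ 1 → ‖G p‖ ≤ 1 / 2 := fun p hp ↦ by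
      rw [hG1 p (by linarith), norm_radialMap_eq]
      have : timeFn s₁ (F p) ≤ 1 := hp
      linarith
    have hnG2 : ∀ p, 1 < T p → 1 / 2 < ‖G p‖ := fun p hp ↦ by
      rw [hG2 p hp, norm_smul]
      have := hf1 (π p) (T p) hp (hTle p)
      norm_num
      linarith
    rcases le_or_gt (T p) 1 with hp | hp <;> rcases le_or_gt (T q) 1 with hq | hq
    · rw [hG1 p (by linarith), hG1 q (by linarith)] at hpq
      exact hFi (radialMap_injective hs₁ hpq)
    · exfalso
      linarith [hnG1 p hp, hnG2 q hq, congrArg norm hpq]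
    · exfalso
      linarith [hnG2 p hp, hnG1 q hq, congrArg norm hpq]
    · rw [hG2 p hp, hG2 q hq] at hpq
      have h' := smul_right_injective (𝔼 4) (by norm_num : (1 / 2 : ℝ) ≠ 0) hpq
      have hpq' := hfinj ⟨mem_univ _, hp.le, hTle p⟩ ⟨mem_univ _, hq.le, hTle q⟩ h'
      simp only [Prod.mk.injEq] at hpq'
      obtain ⟨hπpq, hTpq⟩ := hpq'
      have hn : ‖F p‖ = ‖F q‖ := norm_eq_of_timeFn_eq hs₁ hTpq
      apply hFi
      rw [hradS' p hp, hradS' q hq, hn, hπpq]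
  · -- immersion
    intro p
    rcases lt_or_ge (T p) (1 + δ) with hp | hp
    · rw [(hG1ev p hp).mfderiv_eq, mfderiv_comp p (hdΘ (F p)) (hdF p)]
      exact hΘFinj p
    · have hp1 : 1 < T p := by linarith
      have hdΨ : MDifferentiableAt (𝓡∂ 2) ((𝓡 1).prod 𝓘(ℝ, ℝ)) Ψ p :=
        (hΨs p hp1).mdifferentiableAt (by simp)
      -- the derivative of `Ψ = (π, T)` is injective since `cone ∘ Ψ = 2 Θ ∘ F` near `p`
      have key : (mfderiv ((𝓡 1).prod 𝓘(ℝ, ℝ)) 𝓘(ℝ, 𝔼 4) (cone K) (Ψ p)).comp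
          (mfderiv (𝓡∂ 2) ((𝓡 1).prod 𝓘(ℝ, ℝ)) Ψ p) =
          (2 : ℝ) • ((mfderiv 𝓘(ℝ, 𝔼 4) 𝓘(ℝ, 𝔼 4) (radialMap s₁) (F p)).comp
            (mfderiv (𝓡∂ 2) 𝓘(ℝ, 𝔼 4) F p)) := by
        rw [← mfderiv_comp p (hdcone (Ψ p)) hdΨ, (hconeev p hp1).mfderiv_eq,
          const_smul_mfderiv ((hdΘ (F p)).comp p (hdF p)), mfderiv_comp p (hdΘ (F p)) (hdF p)]
        rfl
      have hinjΨ : Injective (mfderiv (𝓡∂ 2) ((𝓡 1).prod 𝓘(ℝ, ℝ)) Ψ p) := by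
        have h2 : Injective ((mfderiv ((𝓡 1).prod 𝓘(ℝ, ℝ)) 𝓘(ℝ, 𝔼 4) (cone K) (Ψ p)).comp
            (mfderiv (𝓡∂ 2) ((𝓡 1).prod 𝓘(ℝ, ℝ)) Ψ p)) := by
          refine injective_of_eq_smul two_ne_zero (hΘFinj p) _ fun v ↦ ?_
          rw [key]
          rfl
        rw [ContinuousLinearMap.coe_comp] at h2
        exact h2.of_comp
      have h3 : Injective ((mfderiv ((𝓡 1).prod 𝓘(ℝ, ℝ)) 𝓘(ℝ, 𝔼 4) f (Ψ p)).comp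
          (mfderiv (𝓡∂ 2) ((𝓡 1).prod 𝓘(ℝ, ℝ)) Ψ p)) := by
        rw [ContinuousLinearMap.coe_comp]
        exact (hfimm (Ψ p) ⟨mem_univ _, hp1.le, hTle p⟩).comp hinjΨ
      rw [(hG2ev p hp1).mfderiv_eq, const_smul_mfderiv ((hdf (Ψ p)).comp p hdΨ),
        mfderiv_comp p (hdf (Ψ p)) hdΨ]
      exact injective_of_eq_smul (by norm_num : (1 / 2 : ℝ) ≠ 0) h3 _ fun v ↦ rfl
  · -- boundary values
    intro x
    have hx : F x = ((K (e x) : 𝕊 3) : 𝔼 4) := hFb x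
    have hn : ‖F x‖ = 1 := by rw [hx, norm_eq_of_mem_sphere]
    have hT : T x = 2 := timeFn_of_norm_eq_one hs₁ hn
    have h1 : 1 < T x := by rw [hT]; norm_num
    have hπx : π x = e x := by
      have h := hradS' x h1
      rw [hn, one_smul, hx] at h
      exact (K.injective (Subtype.ext h)).symm
    rw [hG2 x h1, hT, hfK' (π x), smul_smul, hπx]
    norm_num
  · -- the interior goes into the open ball
    intro p hp
    have h1 : ‖F p‖ < 1 := hint p hp
    have hT2 : T p < 2 := timeFn_lt_two hs₁ h1
    rcases le_or_gt (T p) 1 with hp' | hp'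
    · rw [hG1 p (by linarith), norm_radialMap]
      nlinarith [profile_le_one (s₁ := s₁) (‖F p‖ ^ 2), norm_nonneg (F p),
        profile_pos (s₁ := s₁) (‖F p‖ ^ 2)]
    · rw [hG2 p hp', norm_smul]
      have := (hshell (π p) (T p) ⟨hp', hT2⟩).2
      norm_num
      linarith

end Knot

end Literature.Topology.FourManifolds
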